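import Summits.NavierStokesRegularity.NavierStokesRegularity.Theorems.SheetLaws
import Summits.NavierStokesRegularity.NavierStokesRegularity.Theorems.SheetLawsHadamardZ
import HarnessLib

/-!
# SHEET LAWS (ROUND-21 of nsreg-p2), engine step (1): kinematics of the odd-swirl class and the
# smooth even representative `χ̃ = zQuot Γ` of the odd contrast `χ = Γ/z`

Prover seat nsreg-p4 (gen 14), line material of the route `SwirlThreshold`
(`--supports stmt-NavierStokesRegularity-2002`); theorems only.  PARITY CERTIFICATE of the planner's
odd-class bookkeeping (nsreg-p2 g23, s21-3 skeleton, proofs taken over): in the axisymmetric odd class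
(`SheetLaws.IsOddSwirlClass`) the swirl `Γ` and `u_z` are ODD in `z` (`swirl_reflZ`, `apply_two_reflZ`)
and vanish on the sheet (`swirl_eq_zero_of_sheet`, `apply_two_eq_zero_of_sheet`); the contrast
`χ = Γ/z` and the compression `-u_z/z` are EVEN; `Γ`, `χ` vanish on the axis.  Then the smooth
representative: off the sheet `oddContrast v = zQuot (swirl v)` (`oddContrast_eq_zQuot`) and
`sheetCompression v = -zQuot (u_z)` (`sheetCompression_eq_neg_zQuot`); `χ̃ = zQuot (swirl v)` is even
(`zQuot_swirl_reflZ`), has `∂₂χ̃ = 0` on the sheet (`fderiv_zQuot_swirl_two_of_sheet`) and vanishes on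
the axis (`zQuot_swirl_eq_zero_of_axis`); an approximation device from off the sheet
(`tendsto_sheetApprox` & co.) transfers closed pointwise conditions to sheet points.

WHAT THIS IS NOT: kinematics; nothing here is a statement about the Navier–Stokes dynamics.
-/

namespace Summit.NavierStokesRegularity.NavierStokesRegularity.Theorems.SheetLaws

open MeasureTheory Set Filter Topology Metric WithLp Function
open scoped ContDiff RealInnerProductSpace
open Literature.Analysis Literature.Analysis.FluidPDE

noncomputable section

/-! ## Parity under the half-turn and the reflection through the sheet -/

/-- The swirl is odd under the half-turn. -/
theorem IsOddSwirlClass.swirl_halfTurn {v : EuclideanSpace ℝ (Fin 3) → EuclideanSpace ℝ (Fin 3)}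
    (h : IsOddSwirlClass v) (x : EuclideanSpace ℝ (Fin 3)) : swirl v (halfTurn x) = -swirl v x := by
  simp only [swirl, h x, halfTurn_apply_zero, halfTurn_apply_one]
  ring

/-- The vertical velocity is odd under the half-turn. -/
theorem IsOddSwirlClass.apply_two_halfTurn
    {v : EuclideanSpace ℝ (Fin 3) → EuclideanSpace ℝ (Fin 3)}
    (h : IsOddSwirlClass v) (x : EuclideanSpace ℝ (Fin 3)) : v (halfTurn x) 2 = -v x 2 := by
  rw [h x, halfTurn_apply_two]

/-- A rotation about the axis takes the half-turned point to the reflected point (the angle is twice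
the azimuth of `x`). -/
theorem exists_rotZ_halfTurn_eq_reflZ (x : EuclideanSpace ℝ (Fin 3)) :
    ∃ θ : ℝ, rotZ θ (halfTurn x) = reflZ x := by
  by_cases h0 : x 0 = 0 ∧ x 1 = 0
  · refine ⟨0, ?_⟩
    ext i; fin_cases i <;> simp [rotZ, reflZ, halfTurn, h0.1, h0.2]
  · let z : ℂ := ⟨x 0, x 1⟩
    have hz : z ≠ 0 := by
      intro h
      apply h0
      exact ⟨by simpa [z] using congrArg Complex.re h, by simpa [z] using congrArg Complex.im h⟩
    have hn : ‖z‖ ≠ 0 := norm_ne_zero_iff.2 hz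
    have hc : x 0 = ‖z‖ * Real.cos (Complex.arg z) := by
      rw [Complex.cos_arg hz]; field_simp; rfl
    have hs : x 1 = ‖z‖ * Real.sin (Complex.arg z) := by
      rw [Complex.sin_arg]; field_simp; rfl
    refine ⟨2 * Complex.arg z, ?_⟩
    have pyth := Real.sin_sq_add_cos_sq (Complex.arg z)
    ext i; fin_cases i
    · simp [rotZ, reflZ, halfTurn, Real.cos_two_mul, Real.sin_two_mul]
      linear_combination (2 * Real.cos (Complex.arg z) ^ 2 - 2) * hc +
        (2 * Real.sin (Complex.arg z) * Real.cos (Complex.arg z)) * hs +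
        (2 * ‖z‖ * Real.cos (Complex.arg z)) * pyth
    · simp [rotZ, reflZ, halfTurn, Real.cos_two_mul, Real.sin_two_mul]
      linear_combination (2 * Real.sin (Complex.arg z) * Real.cos (Complex.arg z)) * hc -
        (2 * Real.cos (Complex.arg z) ^ 2) * hs
    · simp [rotZ, reflZ, halfTurn]

/-- **`Γ` is odd in `z`** in the axisymmetric odd class. -/
theorem swirl_reflZ {v : EuclideanSpace ℝ (Fin 3) → EuclideanSpace ℝ (Fin 3)}
    (hax : IsAxisymmetric v) (hodd : IsOddSwirlClass v) (x : EuclideanSpace ℝ (Fin 3)) :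
    swirl v (reflZ x) = -swirl v x := by
  obtain ⟨θ, hθ⟩ := exists_rotZ_halfTurn_eq_reflZ x
  rw [← hθ, hax.swirl_rotZ, hodd.swirl_halfTurn]

/-- **`u_z` is odd in `z`** in the axisymmetric odd class. -/
theorem apply_two_reflZ {v : EuclideanSpace ℝ (Fin 3) → EuclideanSpace ℝ (Fin 3)}
    (hax : IsAxisymmetric v) (hodd : IsOddSwirlClass v) (x : EuclideanSpace ℝ (Fin 3)) :
    v (reflZ x) 2 = -v x 2 := by
  obtain ⟨θ, hθ⟩ := exists_rotZ_halfTurn_eq_reflZ x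
  rw [← hθ, hax θ, rotZ_apply_two, hodd.apply_two_halfTurn]

/-- `Γ = 0` on the sheet. -/
theorem swirl_eq_zero_of_sheet {v : EuclideanSpace ℝ (Fin 3) → EuclideanSpace ℝ (Fin 3)}
    (hax : IsAxisymmetric v) (hodd : IsOddSwirlClass v) {x : EuclideanSpace ℝ (Fin 3)}
    (hx : x 2 = 0) : swirl v x = 0 := by
  have h := swirl_reflZ hax hodd x
  rw [reflZ_eq_self_of_sheet hx] at h
  linarith

/-- `u_z = 0` on the sheet. -/
theorem apply_two_eq_zero_of_sheet {v : EuclideanSpace ℝ (Fin 3) → EuclideanSpace ℝ (Fin 3)}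
    (hax : IsAxisymmetric v) (hodd : IsOddSwirlClass v) {x : EuclideanSpace ℝ (Fin 3)}
    (hx : x 2 = 0) : v x 2 = 0 := by
  have h := apply_two_reflZ hax hodd x
  rw [reflZ_eq_self_of_sheet hx] at h
  linarith

/-- `Γ = 0` on the axis (no parity needed). -/
theorem swirl_eq_zero_of_axis (v : EuclideanSpace ℝ (Fin 3) → EuclideanSpace ℝ (Fin 3))
    {x : EuclideanSpace ℝ (Fin 3)} (h0 : x 0 = 0) (h1 : x 1 = 0) : swirl v x = 0 := by
  simp [swirl, h0, h1]

/-- **The contrast `χ = Γ/z` is even in `z`**. -/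
theorem oddContrast_reflZ {v : EuclideanSpace ℝ (Fin 3) → EuclideanSpace ℝ (Fin 3)}
    (hax : IsAxisymmetric v) (hodd : IsOddSwirlClass v) (x : EuclideanSpace ℝ (Fin 3)) :
    oddContrast v (reflZ x) = oddContrast v x := by
  rw [oddContrast, oddContrast, swirl_reflZ hax hodd, reflZ_apply_two, neg_div_neg_eq]

/-- `χ = 0` on the axis. -/
theorem oddContrast_eq_zero_of_axis (v : EuclideanSpace ℝ (Fin 3) → EuclideanSpace ℝ (Fin 3))
    {x : EuclideanSpace ℝ (Fin 3)} (h0 : x 0 = 0) (h1 : x 1 = 0) : oddContrast v x = 0 := by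
  rw [oddContrast, swirl_eq_zero_of_axis v h0 h1, zero_div]

/-- **The compression rate `-u_z/z` is even in `z`.** -/
theorem sheetCompression_reflZ {v : EuclideanSpace ℝ (Fin 3) → EuclideanSpace ℝ (Fin 3)}
    (hax : IsAxisymmetric v) (hodd : IsOddSwirlClass v) (x : EuclideanSpace ℝ (Fin 3)) :
    sheetCompression v (reflZ x) = sheetCompression v x := by
  rw [sheetCompression, sheetCompression, apply_two_reflZ hax hodd, reflZ_apply_two, neg_div_neg_eq]

/-! ## The smooth representatives `χ̃ = zQuot Γ` and `c̃ = zQuot u_z` -/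

section Smooth

variable {v : EuclideanSpace ℝ (Fin 3) → EuclideanSpace ℝ (Fin 3)}

/-- Off the sheet the odd contrast IS the Hadamard quotient of the swirl: `χ = zQuot Γ`. -/
theorem oddContrast_eq_zQuot (hv : ContDiff ℝ 1 v) (hax : IsAxisymmetric v) (hodd : IsOddSwirlClass v)
    {x : EuclideanSpace ℝ (Fin 3)} (hx : x 2 ≠ 0) : oddContrast v x = zQuot (swirl v) x := by
  rw [oddContrast, zQuot_eq_div (contDiff_swirl hv) (fun y hy => swirl_eq_zero_of_sheet hax hodd hy) hx]

/-- Off the sheet the compression rate is minus the Hadamard quotient of `u_z`: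
`-u_z/z = -zQuot (u_z)`. -/
theorem sheetCompression_eq_neg_zQuot (hv : ContDiff ℝ 1 v) (hax : IsAxisymmetric v)
    (hodd : IsOddSwirlClass v) {x : EuclideanSpace ℝ (Fin 3)} (hx : x 2 ≠ 0) :
    sheetCompression v x = -zQuot (fun y => v y 2) x := by
  have h1 : ContDiff ℝ 1 fun y => v y 2 := contDiff_euclidean.1 hv 2
  rw [sheetCompression, zQuot_eq_div h1 (fun y hy => apply_two_eq_zero_of_sheet hax hodd hy) hx]

/-- On the axis `∂₂Γ = 0` (indeed `DΓ(x) e₂ = ⟪J x, Dv e₂⟫ + ⟪J e₂, v⟫` and both `J x`, `J e₂` vanish). -/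
theorem fderiv_swirl_two_eq_zero_of_axis (hv : ContDiff ℝ 1 v) {x : EuclideanSpace ℝ (Fin 3)}
    (h0 : x 0 = 0) (h1 : x 1 = 0) :
    fderiv ℝ (swirl v) x (EuclideanSpace.single 2 1) = 0 := by
  have hd : DifferentiableAt ℝ v x := (hv.differentiable one_ne_zero) x
  rw [fderiv_swirl_apply hd]
  have hJx : rotGen x = 0 := by
    ext i; fin_cases i <;> simp [rotGen, h0, h1]
  rw [hJx, rotGen_single_two, inner_zero_left, inner_zero_left, add_zero]

/-- **`χ̃ = zQuot Γ` vanishes on the axis** (off the sheet it is `Γ/z` with `Γ = 0` there; at the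
origin-type points it is `∂₂Γ = 0`). -/
theorem zQuot_swirl_eq_zero_of_axis (hv : ContDiff ℝ 1 v) (hax : IsAxisymmetric v)
    (hodd : IsOddSwirlClass v) {x : EuclideanSpace ℝ (Fin 3)} (h0 : x 0 = 0) (h1 : x 1 = 0) :
    zQuot (swirl v) x = 0 := by
  by_cases hz : x 2 = 0
  · rw [zQuot_of_sheet ((differentiableAt_swirl ((hv.differentiable one_ne_zero) x))) hz,
      fderiv_swirl_two_eq_zero_of_axis hv h0 h1]
  · rw [← oddContrast_eq_zQuot hv hax hodd hz, oddContrast_eq_zero_of_axis v h0 h1]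

/-- **`χ̃` is even in `z`** (everywhere: off the sheet by `oddContrast_reflZ`, on the sheet trivially). -/
theorem zQuot_swirl_reflZ (hv : ContDiff ℝ 1 v) (hax : IsAxisymmetric v) (hodd : IsOddSwirlClass v)
    (x : EuclideanSpace ℝ (Fin 3)) : zQuot (swirl v) (reflZ x) = zQuot (swirl v) x := by
  by_cases hz : x 2 = 0
  · rw [reflZ_eq_self_of_sheet hz]
  · have hz' : reflZ x 2 ≠ 0 := by simpa using hz
    rw [← oddContrast_eq_zQuot hv hax hodd hz', ← oddContrast_eq_zQuot hv hax hodd hz,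
      oddContrast_reflZ hax hodd]

/-- **`∂₂χ̃ = 0` on the sheet**: an even `C¹` function has vanishing vertical derivative at the
points fixed by the reflection. -/
theorem fderiv_zQuot_swirl_two_of_sheet (hv : ContDiff ℝ 2 v) (hax : IsAxisymmetric v)
    (hodd : IsOddSwirlClass v) {x : EuclideanSpace ℝ (Fin 3)} (hx : x 2 = 0) :
    fderiv ℝ (zQuot (swirl v)) x (EuclideanSpace.single 2 1) = 0 := by
  set g := zQuot (swirl v) with hg
  have hg1 : ContDiff ℝ 1 g := contDiff_zQuot (n := 1) (contDiff_swirl (by exact_mod_cast hv))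
  have hgd : DifferentiableAt ℝ g x := (hg1.differentiable one_ne_zero) x
  have heven : (fun y => g (reflZ y)) = g :=
    funext fun y => zQuot_swirl_reflZ (hv.of_le one_le_two) hax hodd y
  have hc : HasFDerivAt (fun y => g (reflZ y)) ((fderiv ℝ g x).comp reflZL) x := by
    have h1 : HasFDerivAt g (fderiv ℝ g x) (reflZ x) := by
      rw [reflZ_eq_self_of_sheet hx]; exact hgd.hasFDerivAt
    exact h1.comp x (hasFDerivAt_reflZ x)
  rw [heven] at hc
  have h2 := congrArg (fun L : EuclideanSpace ℝ (Fin 3) →L[ℝ] ℝ => L (EuclideanSpace.single 2 1))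
    hc.fderiv
  simp only [ContinuousLinearMap.comp_apply, reflZL_apply, reflZ_single_two, map_neg] at h2
  linarith

/-- Off the sheet `u_z = z · c̃` with `c̃ = zQuot u_z`, everywhere (Hadamard in `z`). -/
theorem apply_two_eq_mul_zQuot (hv : ContDiff ℝ 1 v) (hax : IsAxisymmetric v)
    (hodd : IsOddSwirlClass v) (x : EuclideanSpace ℝ (Fin 3)) :
    v x 2 = x 2 * zQuot (fun y => v y 2) x := by
  have h1 : ContDiff ℝ 1 fun y => v y 2 := contDiff_euclidean.1 hv 2
  rw [mul_zQuot h1 (fun y hy => apply_two_eq_zero_of_sheet hax hodd hy) x]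

/-- `Γ = z · χ̃` everywhere. -/
theorem swirl_eq_mul_zQuot (hv : ContDiff ℝ 1 v) (hax : IsAxisymmetric v)
    (hodd : IsOddSwirlClass v) (x : EuclideanSpace ℝ (Fin 3)) :
    swirl v x = x 2 * zQuot (swirl v) x := by
  rw [mul_zQuot (contDiff_swirl hv) (fun y hy => swirl_eq_zero_of_sheet hax hodd hy) x]

end Smooth

/-! ## Approximating sheet points from off the sheet -/

section Approx

/-- The vertical approximants `x + (n+1)⁻¹ e₂` of a point `x`. -/
theorem tendsto_sheetApprox (x : EuclideanSpace ℝ (Fin 3)) :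
    Tendsto (fun n : ℕ => x + ((n : ℝ) + 1)⁻¹ • EuclideanSpace.single (2 : Fin 3) (1 : ℝ)) atTop
      (𝓝 x) := by
  have h1 : Tendsto (fun n : ℕ => ((n : ℝ) + 1)⁻¹) atTop (𝓝 0) :=
    tendsto_one_div_add_atTop_nhds_zero_nat.congr fun n => by rw [one_div]
  have h2 : Tendsto (fun n : ℕ => ((n : ℝ) + 1)⁻¹ • EuclideanSpace.single (2 : Fin 3) (1 : ℝ)) atTop
      (𝓝 0) := by
    simpa using h1.smul_const (EuclideanSpace.single (2 : Fin 3) (1 : ℝ))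
  simpa using tendsto_const_nhds.add h2

/-- The approximants of a SHEET point lie off the sheet. -/
theorem sheetApprox_apply_two {x : EuclideanSpace ℝ (Fin 3)} (hx : x 2 = 0) (n : ℕ) :
    (x + ((n : ℝ) + 1)⁻¹ • EuclideanSpace.single (2 : Fin 3) (1 : ℝ)) 2 = ((n : ℝ) + 1)⁻¹ := by
  simp [hx]

/-- The approximants of a sheet point lie off the sheet. -/
theorem sheetApprox_apply_two_ne_zero {x : EuclideanSpace ℝ (Fin 3)} (hx : x 2 = 0) (n : ℕ) :
    (x + ((n : ℝ) + 1)⁻¹ • EuclideanSpace.single (2 : Fin 3) (1 : ℝ)) 2 ≠ 0 := by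
  rw [sheetApprox_apply_two hx]
  positivity

/-- The approximants have the same horizontal coordinates, hence the same cylindrical radius. -/
theorem cylRadius_sheetApprox (x : EuclideanSpace ℝ (Fin 3)) (n : ℕ) :
    cylRadius (x + ((n : ℝ) + 1)⁻¹ • EuclideanSpace.single (2 : Fin 3) (1 : ℝ)) = cylRadius x := by
  simp [cylRadius]

/-- The approximants of a sheet point are not closer to the origin: `‖x‖ ≤ ‖x + δ e₂‖` when `x₂ = 0`. -/
theorem norm_le_norm_sheetApprox {x : EuclideanSpace ℝ (Fin 3)} (hx : x 2 = 0) (n : ℕ) :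
    ‖x‖ ≤ ‖x + ((n : ℝ) + 1)⁻¹ • EuclideanSpace.single (2 : Fin 3) (1 : ℝ)‖ := by
  have h1 : ‖x‖ ^ 2 ≤ ‖x + ((n : ℝ) + 1)⁻¹ • EuclideanSpace.single (2 : Fin 3) (1 : ℝ)‖ ^ 2 := by
    rw [EuclideanSpace.norm_sq_eq, EuclideanSpace.norm_sq_eq]
    simp [Fin.sum_univ_three, hx]
    positivity
  exact (pow_le_pow_iff_left₀ (norm_nonneg _) (norm_nonneg _) two_ne_zero).1 h1

/-- **Transfer of a closed pointwise condition to the sheet**: if `g` is continuous at `x`, `x` is a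
sheet point, and `g y ≤ b` at every point `y` off the sheet, then `g x ≤ b`. -/
theorem le_of_forall_off_sheet {g : EuclideanSpace ℝ (Fin 3) → ℝ} {x : EuclideanSpace ℝ (Fin 3)} {b : ℝ}
    (hg : ContinuousAt g x) (hx : x 2 = 0)
    (h : ∀ y : EuclideanSpace ℝ (Fin 3), y 2 ≠ 0 → cylRadius y = cylRadius x → ‖x‖ ≤ ‖y‖ → g y ≤ b) :
    g x ≤ b := by
  have ht := (hg.tendsto.comp (tendsto_sheetApprox x))
  exact le_of_tendsto' ht fun n => h _ (sheetApprox_apply_two_ne_zero hx n)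
    (cylRadius_sheetApprox x n) (norm_le_norm_sheetApprox hx n)

/-- Transfer of a closed pointwise lower bound to the sheet. -/
theorem ge_of_forall_off_sheet {g : EuclideanSpace ℝ (Fin 3) → ℝ} {x : EuclideanSpace ℝ (Fin 3)} {b : ℝ}
    (hg : ContinuousAt g x) (hx : x 2 = 0)
    (h : ∀ y : EuclideanSpace ℝ (Fin 3), y 2 ≠ 0 → cylRadius y = cylRadius x → ‖x‖ ≤ ‖y‖ → b ≤ g y) :
    b ≤ g x := by
  have ht := (hg.tendsto.comp (tendsto_sheetApprox x))
  exact ge_of_tendsto' ht fun n => h _ (sheetApprox_apply_two_ne_zero hx n)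
    (cylRadius_sheetApprox x n) (norm_le_norm_sheetApprox hx n)

/-- Transfer of an identity to the sheet: `g = 0` off the sheet and `g` continuous at the sheet point
`x` give `g x = 0`. -/
theorem eq_zero_of_forall_off_sheet {g : EuclideanSpace ℝ (Fin 3) → ℝ} {x : EuclideanSpace ℝ (Fin 3)}
    (hg : ContinuousAt g x) (hx : x 2 = 0)
    (h : ∀ y : EuclideanSpace ℝ (Fin 3), y 2 ≠ 0 → cylRadius y = cylRadius x → g y = 0) :
    g x = 0 :=
  le_antisymm (le_of_forall_off_sheet hg hx fun y hy hr _ => (h y hy hr).le)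
    (ge_of_forall_off_sheet hg hx fun y hy hr _ => (h y hy hr).ge)

end Approx

end

end Summit.NavierStokesRegularity.NavierStokesRegularity.Theorems.SheetLaws
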